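import Literature.AlgebraicGeometry.Resolution.PermissibleBlowupDirectrixNear
import Literature.AlgebraicGeometry.Resolution.HilbertSamuelLowerBound
import Literature.AlgebraicGeometry.Resolution.DirectrixSchemeLocal
import Literature.AlgebraicGeometry.Resolution.BlowupReducedDimension
import Summits.ResolutionOfSingularities.ResolutionOfSingularities.Theorems.HilbertSamuelEliminationSigmaMaxModificationsCorridor3WLadderDefs
import Summits.ResolutionOfSingularities.ResolutionOfSingularities.Theorems.HilbertSamuelEliminationCampaignW42TertiaryGeneralStrata
import Summits.ResolutionOfSingularities.ResolutionOfSingularities.Theorems.HilbertSamuelEliminationCampaignW42NearChainCorridor3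
import Summits.ResolutionOfSingularities.ResolutionOfSingularities.Theorems.HilbertSamuelEliminationSigmaMaxModificationsCorridor3WLadderStrataLineages
import HarnessLib

/-!
# [OURS · L1 W4.2] W-MONO: `ē` does not increase along a canonical near step — crux chain w42, line `w_ladder` v5,
# registered stub `stub_Wmono` (skeleton e55bf4f23146f08b on stmt-ResolutionOfSingularities-19249), CLOSED MODULO the
# printed fact CJS Thm. 3.10 (4) (`Literature…CossartJannsenSaito2020_thm_3_10_4`)

OURS (cell res-hironaka, slot W4.2, LEAD PROVER res-L1-w42-lead-1 gen 3); NOT statements of H. Hironaka's manuscript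
[Hironaka2017]; AI proving, weaker than expert review. `--supports stmt-ResolutionOfSingularities-19249`.

THE ROW. `Helpers.ClosedOriginGeomDirDimNonincrease p N` (module `…Corridor3WLadderDefs`, §B «W-mono (M)»): for every
functional admissible oracle `R`, every value `ν`, every marked stage `s` REACHED along `S(X, ν)` from a maximal origin
`(X, x)` of characteristic `p` at level `N` (`IsMaximalOrigin`: `X` reduced, separated, of finite type over a field, `dim X ≤ N`,
`ν ∈ Σ_X^{N,max}`, `x ∈ X(ν)` closed) and every canonical near step `s → s'`: `ē_{x_{n+1}}(X_{n+1}) ≤ ē_{x_n}(X_n)`.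

THE PROOF (this file, sorry-free; one printed premise). Write the step as `X_{n+1} = Bl_C(X_n)`, `x_{n+1} ↦ x_n`,
`x_{n+1} ∈ X_{n+1}(ν)` closed (tree `CampaignW42.CanonicalNearStep`).
* DEGENERATE VALUE `ν = Φ^{(N)}` (the Hilbert–Samuel function of a regular point): `x_n ∈ X_n(ν) = Reg(X_n) ∩ {dim ≤ N}`
  (tree `Scheme.hsStratum_iterPSum_Phi`, CJS Lemma 2.31), so `𝒪_{X_n,x_n}` is regular and `ē_{x_n} = emb.dim = dim 𝒪_{X_n,x_n}`
  (`Scheme.geomDirDim_eq_spanFinrank_of_isRegularLocalRing`); blowing up never raises the dimension of local rings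
  (`IsBlowup.ringKrullDim_stalk_le_of_isLocallyNoetherian`, Matsumura Thm. 15.5) and `ē ≤ dim` (CJS Def. 2.21), whence
  `ē_{x_{n+1}} ≤ dim 𝒪_{X_{n+1},x_{n+1}} ≤ dim 𝒪_{X_n,x_n} = ē_{x_n}` — NO hypothesis on the centre (`geomDirDim_le_of_mem_regularLocus`).
* GENERIC VALUE `ν ≠ Φ^{(N)}`: the s42 STATE INVARIANT `CampaignW42.StateGood` holds at the origin for an arbitrary maximal
  stratum (`stateGood_init_general`: finite type over the field, `dim ≤ N`, `ν` never exceeded, ALL CANONICAL CENTRES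
  PERMISSIBLE — CJS Lemma 5.34 (3) / Thm. 3.3 in the tree's rendering, `cycleInvariant_runs`) and propagates along canonical
  steps (`StateGood.next`); we carry it along `Reaches` together with «the marked point lies in the `ν`-stratum»
  (`stateGood_and_mem_of_reaches`). At the step: the stage is excellent (finite type over a field), the centre `C` is permissible
  (`StateGood.isPermissible`), and `x_{n+1}` is NEAR to `x_n` (`H^N(x_{n+1}) = ν = H^N(x_n)`). If `x_n ∉ V(C)` the blow-up
  is a local isomorphism at `x_{n+1}` and `ē` is unchanged (`geomDirDim_blowup_eq_of_notMem_support`, GW Prop. 13.91 (3));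
  if `x_n ∈ V(C)`, CJS Thm. 3.10 (4) — the NAMED PRINTED FACT `CossartJannsenSaito2020_thm_3_10_4` (Hironaka [H2]
  Thm. (1,A)), through its proved consequence `geomDirDim_le_of_hsFun_eq_of_isClosed` (closed near point ⇒ residue
  extension finite ⇒ `δ = 0`, `e_x(X)_{k̄(x')} = ē_x(X)`) — gives `ē_{x_{n+1}} ≤ ē_{x_n}`.

HEADLINES: `closedOriginGeomDirDimNonincrease_of_thm_3_10_4 (h) p N : ClosedOriginGeomDirDimNonincrease p N` (every `p`,
every level `N`); `stub_Wmono_of_thm_3_10_4 (h) : ∀ p, p.Prime → ClosedOriginGeomDirDimNonincrease.{0} p 3` = the REGISTERED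
signature of `stub_Wmono` modulo the fact; `geomDirDimNonincrease_of_thm_3_10_4 (h) p : CampaignW42.GeomDirDimNonincrease p`
(the s42 assembly hypothesis at ISOLATED origins, `…CampaignW42Tertiary`, via `IsIsolatedOrigin.isMaximalOrigin`).

## References

* V. Cossart, U. Jannsen, S. Saito, LNM 2270 (2020), Thm. 3.10 (2)/(4), Def. 2.21, Def. 2.26, Lemma 2.31, Def. 3.1,
  Thm. 3.3, Lemma 5.34 (3), Rem. 6.29 (1). [CossartJannsenSaito2020]
* H. Matsumura, *Commutative Ring Theory* (1987), Thm. 15.5. [Matsumura1987]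
* U. Görtz, T. Wedhorn, *Algebraic Geometry I* (2nd ed. 2020), Prop. 13.91 (3). [GortzWedhorn2020]
-/

noncomputable section

set_option linter.dupNamespace false -- mandated namespace of this single-conjunct summit

open CategoryTheory AlgebraicGeometry TopologicalSpace IsLocalRing
open Literature.AlgebraicGeometry.Resolution Literature.RingTheory.HilbertSamuel
open Summit.ResolutionOfSingularities.ResolutionOfSingularities.Theorems.CampaignW42

namespace Summit.ResolutionOfSingularities.ResolutionOfSingularities.Theorems.SigmaMaxModificationsCorridor3.Helpers

universe u

/-! ## `ē` along ONE blow-up: off the centre, and over a regular point -/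

/-- **Off its centre a blow-up preserves `ē`**: for `y ∈ Bl_C(W)` with `π(y) ∉ V(C)`, `ē_y(Bl_C W) = ē_{π y}(W)` (`π` is an
isomorphism over `W ∖ V(C)`, GW Prop. 13.91 (3); `ē` depends only on the local ring). [cite: GortzWedhorn2020, Prop. 13.91 (3)]
[cite: CossartJannsenSaito2020, Def. 2.26] -/
theorem geomDirDim_blowup_eq_of_notMem_support {W : Scheme.{u}} [IsLocallyNoetherian W] (C : W.IdealSheafData)
    [IsLocallyNoetherian (blowup C)] (y : ↥(blowup C)) (hy : (blowup.π C).base y ∉ (C.support : Set W)) :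
    Scheme.geomDirDim (blowup C) y = Scheme.geomDirDim W ((blowup.π C).base y) := by
  let U : W.Opens := ⟨(C.support : Set W)ᶜ, C.support.isClosed.isOpen_compl⟩
  haveI : IsIso (blowup.π C ∣_ U) := (blowup.isBlowup C).isIso_compl
  exact Scheme.geomDirDim_eq_of_isIso_morphismRestrict (blowup.π C) U y hy

/-- **Over a REGULAR point a blow-up cannot raise `ē`**: if `𝒪_{W,π y}` is regular then `ē_y(W') ≤ dim 𝒪_{W',y} ≤ dim 𝒪_{W,π y} =
emb.dim 𝒪_{W,π y} = ē_{π y}(W)` — blowing up never raises the dimension of the local rings (Matsumura Thm. 15.5, tree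
`IsBlowup.ringKrullDim_stalk_le_of_isLocallyNoetherian`), `ē ≤ dim` (CJS Def. 2.21) and `ē = emb.dim = dim` at a regular point
(CJS Def. 2.26). No hypothesis on the centre. [cite: CossartJannsenSaito2020, Def. 2.21, Def. 2.26] [cite: Matsumura1987, Thm. 15.5] -/
theorem geomDirDim_le_of_mem_regularLocus {W W' : Scheme.{u}} [IsLocallyNoetherian W] [IsLocallyNoetherian W']
    {π : W' ⟶ W} {I : W.IdealSheafData} (hπ : IsBlowup π I) (y : W')
    (hreg : π.base y ∈ Scheme.regularLocus W) : Scheme.geomDirDim W' y ≤ Scheme.geomDirDim W (π.base y) := by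
  haveI : IsRegularLocalRing (W.presheaf.stalk (π.base y)) := hreg
  have h1 : (Scheme.geomDirDim W' y : WithBot ℕ∞) ≤ ringKrullDim (W'.presheaf.stalk y) :=
    Scheme.natCast_geomDirDim_le_ringKrullDim_stalk y
  have h2 : ringKrullDim (W'.presheaf.stalk y) ≤ ringKrullDim (W.presheaf.stalk (π.base y)) :=
    hπ.ringKrullDim_stalk_le_of_isLocallyNoetherian y
  have h3 : ringKrullDim (W.presheaf.stalk (π.base y)) = ((maximalIdeal (W.presheaf.stalk (π.base y))).spanFinrank : ℕ) :=
    (IsRegularLocalRing.spanFinrank_maximalIdeal (R := W.presheaf.stalk (π.base y))).symm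
  have h4 : Scheme.geomDirDim W (π.base y) = (maximalIdeal (W.presheaf.stalk (π.base y))).spanFinrank :=
    Scheme.geomDirDim_eq_spanFinrank_of_isRegularLocalRing (π.base y)
  have h : (Scheme.geomDirDim W' y : WithBot ℕ∞) ≤ ((maximalIdeal (W.presheaf.stalk (π.base y))).spanFinrank : ℕ) :=
    (h1.trans h2).trans h3.le
  rw [h4]
  exact_mod_cast h

/-! ## `ē` along one CANONICAL NEAR STEP -/

variable {R : ∀ S : Scheme.{u}, CentreSeq S → Prop} {N : ℕ} {ν : ℕ → ℕ}

/-- **Degenerate value.** If the marked point of `s` is a REGULAR point of its stage, `ē` does not increase along any canonical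
near step from `s` (no hypothesis on the oracle or the centre). [cite: CossartJannsenSaito2020, Def. 2.21, Def. 2.26] -/
theorem geomDirDim_le_of_canonicalNearStep_of_mem_regularLocus {s s' : MarkedStage.{u}}
    (hreg : s.pt ∈ @Scheme.regularLocus s.W) (hst : CanonicalNearStep R N ν s s') : s'.geomDirDim ≤ s.geomDirDim := by
  obtain ⟨C, P', hln, x', -, hπ, -, -, rfl⟩ := hst
  haveI : IsLocallyNoetherian s.W := s.ln
  haveI : IsLocallyNoetherian (blowup C) := hln
  have h := geomDirDim_le_of_mem_regularLocus (blowup.isBlowup C) x' (hπ ▸ hreg)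
  rw [hπ] at h
  exact h

/-- **Generic value.** From a stage whose state is GOOD (s42 `CampaignW42.StateGood`: finite type over the field `k`, `dim ≤ N`,
`ν` never exceeded, canonical centres permissible) and whose marked point lies in the `ν`-stratum, `ē` does not increase along a
canonical near step — off the centre by GW Prop. 13.91 (3), over the centre by CJS Thm. 3.10 (4) (the named printed fact, at
the CLOSED near point `x_{n+1}`: `H^N(x_{n+1}) = ν = H^N(x_n)`). [cite: CossartJannsenSaito2020, Thm. 3.10 (4), Lemma 5.34 (3)] -/
theorem geomDirDim_le_of_canonicalNearStep_of_stateGood (h : CossartJannsenSaito2020_thm_3_10_4.{u}) {k : Type u} [Field k]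
    {s s' : MarkedStage.{u}} (hgood : StateGood k R N ν s.W s.L s.P) (hmem : s.pt ∈ Scheme.hsStratum s.W N ν)
    (hst : CanonicalNearStep R N ν s s') : s'.geomDirDim ≤ s.geomDirDim := by
  obtain ⟨C, P', hln, x', hcs, hπ, hcl, hx'ν, rfl⟩ := hst
  haveI : IsLocallyNoetherian s.W := s.ln
  haveI : IsLocallyNoetherian (blowup C) := hln
  show Scheme.geomDirDim (blowup C) x' ≤ Scheme.geomDirDim s.W s.pt
  by_cases hxC : s.pt ∈ (C.support : Set s.W)
  · -- over the centre: CJS Thm. 3.10 (4) at the closed near point `x'`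
    have hnear : Scheme.hsFun (blowup C) N x' = Scheme.hsFun s.W N ((blowup.π C).base x') := by
      rw [Scheme.mem_hsStratum_iff.mp hx'ν, hπ]
      exact (Scheme.mem_hsStratum_iff.mp hmem).symm
    have hle := geomDirDim_le_of_hsFun_eq_of_isClosed h hgood.isExcellent (hgood.isPermissible hcs) (blowup.isBlowup C)
      hgood.dim_le (x' := x') (hπ.symm ▸ hxC) hcl hnear
    rwa [hπ] at hle
  · -- off the centre: the blow-up is a local isomorphism at `x'`
    rw [← hπ] at hxC ⊢
    exact (geomDirDim_blowup_eq_of_notMem_support C x' hxC).le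

/-! ## The invariant carried along `Reaches` from a maximal origin (generic value) -/

/-- The bookkeeping carried along `Reaches` (generic value): the s42 state invariant `StateGood` over the ground field `k` AND
«the marked point lies in the `ν`-stratum» propagate along canonical near steps (`StateGood.next`; the step lands in the stratum by
definition). [folklore] -/
theorem stateGood_and_mem_of_reaches {k : Type u} [Field k] {s₀ s : MarkedStage.{u}}
    (hgood : StateGood k R N ν s₀.W s₀.L s₀.P) (hmem : s₀.pt ∈ Scheme.hsStratum s₀.W N ν) (h : Reaches R N ν s₀ s) :
    StateGood k R N ν s.W s.L s.P ∧ s.pt ∈ Scheme.hsStratum s.W N ν := by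
  induction h with
  | refl => exact ⟨hgood, hmem⟩
  | tail _ hst ih =>
    obtain ⟨C, P', hln, x', hcs, -, -, hx'ν, rfl⟩ := hst
    exact ⟨ih.1.next hcs, hx'ν⟩

/-- At a maximal origin with `ν ≠ Φ^{(N)}` the state is good over its ground field (`stateGood_init_general`: `X` reduced of finite
type over a field, `dim X ≤ N`, `ν` maximal). [folklore] -/
theorem exists_stateGood_init_of_isMaximalOrigin {p : ℕ} {X : Scheme.{u}} [IsLocallyNoetherian X] {x : X}
    (hX : IsMaximalOrigin p N ν X x) (hν : ν ≠ iterPSum N Phi) (hRa : OracleAdmissible R) :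
    ∃ (k : Type u) (_ : Field k), StateGood k R N ν X (Labelling.init X) none := by
  obtain ⟨k, _, _, f, -, hft, hqc⟩ := hX.exists_structure
  haveI := hft
  haveI := hqc
  haveI := hX.isReduced
  exact ⟨k, inferInstance, stateGood_init_general hRa f hX.dim_le hX.maximal hν⟩

/-! ## W-MONO -/

/-- **W-MONO, every characteristic `p` and every level `N`, MODULO CJS Thm. 3.10 (4)**: along a canonical near step from a stage
reached from a maximal origin, `ē` does not increase (`Helpers.ClosedOriginGeomDirDimNonincrease p N`). [OURS · L1 W4.2] replaces
the role of CJS Thm. 3.10 (4) + Lemma 5.34 (3) for the line `w_ladder`; NOT a statement of the manuscript.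
[cite: CossartJannsenSaito2020, Thm. 3.10 (4), Lemma 2.31, Lemma 5.34 (3)] -/
theorem closedOriginGeomDirDimNonincrease_of_thm_3_10_4 (h : CossartJannsenSaito2020_thm_3_10_4.{u}) (p N : ℕ) :
    ClosedOriginGeomDirDimNonincrease.{u} p N := by
  intro R _ hRa ν s s' hsc hst
  obtain ⟨X, hXln, x, hX, hreach⟩ := hsc
  by_cases hν : ν = iterPSum N Phi
  · -- degenerate value: the marked point is a regular point of its stage
    have hmem := Moving.pt_mem_hsStratum_of_reaches (R := R) hX.mem_stratum hreach
    haveI : IsLocallyNoetherian s.W := s.ln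
    have hreg : s.pt ∈ Scheme.regularLocus s.W := by
      have hmem' : Scheme.hsFun s.W N s.pt = iterPSum N Phi := hν ▸ Scheme.mem_hsStratum_iff.mp hmem
      exact ((Scheme.hsFun_eq_iterPSum_Phi_iff N s.pt).mp hmem').1
    exact geomDirDim_le_of_canonicalNearStep_of_mem_regularLocus hreg hst
  · obtain ⟨k, _, h0⟩ := exists_stateGood_init_of_isMaximalOrigin hX hν hRa
    obtain ⟨hgood, hmem⟩ := stateGood_and_mem_of_reaches (s₀ := MarkedStage.init X x) h0 hX.mem_stratum hreach
    exact geomDirDim_le_of_canonicalNearStep_of_stateGood h hgood hmem hst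

/-- **THE REGISTERED STUB `stub_Wmono` OF SKELETON `w_ladder` v5 (stmt-ResolutionOfSingularities-19249), MODULO THE PRINTED FACT
CJS Thm. 3.10 (4)** — signature verbatim: `∀ p : ℕ, p.Prime → ClosedOriginGeomDirDimNonincrease.{0} p 3`. [OURS · L1 W4.2]; NOT a
statement of the manuscript. [cite: CossartJannsenSaito2020, Thm. 3.10 (4)] -/
theorem stub_Wmono_of_thm_3_10_4 (h : CossartJannsenSaito2020_thm_3_10_4.{0}) :
    ∀ p : ℕ, p.Prime → ClosedOriginGeomDirDimNonincrease.{0} p 3 :=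
  fun p _ => closedOriginGeomDirDimNonincrease_of_thm_3_10_4 h p 3

/-- **The s42 assembly hypothesis `CampaignW42.GeomDirDimNonincrease p` (isolated origins, every level) MODULO CJS Thm. 3.10 (4)**:
an isolated origin is a maximal origin (`IsIsolatedOrigin.isMaximalOrigin`). [OURS · L1 W4.2]; NOT a statement of the manuscript.
[cite: CossartJannsenSaito2020, Thm. 3.10 (4)] -/
theorem geomDirDimNonincrease_of_thm_3_10_4 (h : CossartJannsenSaito2020_thm_3_10_4.{u}) (p : ℕ) :
    GeomDirDimNonincrease.{u} p := by
  intro R hRf hRa N ν s s' hsc hst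
  obtain ⟨X, hXln, x, hX, hreach⟩ := hsc
  exact closedOriginGeomDirDimNonincrease_of_thm_3_10_4 h p N R hRf hRa ν s s' ⟨X, hXln, x, hX.isMaximalOrigin, hreach⟩ hst

end Summit.ResolutionOfSingularities.ResolutionOfSingularities.Theorems.SigmaMaxModificationsCorridor3.Helpers

end
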